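import Mathlib
import HarnessLib
import Summits.HodgeConjecture.HodgeConjecture.Theses.EightfoldTwistedSheafSeeds
import Summits.HodgeConjecture.HodgeConjecture.Theorems.EightfoldBlochSeedsBlochSpreadEightFourOfRelativeClassNear
import Summits.HodgeConjecture.HodgeConjecture.Theorems.EightfoldBlochSeedsBlochSpreadEightFourSupportedClass

/-!
# Crux `BlochSpreadEightFour` (stmt-HodgeConjecture-18884), line `bloch-lifts-fulton`: the crux from Bloch's
# lifting fact and a SUPPORTED CLASS with non-zero central restriction `(SC)`

HONEST FRAMING: a two-line composition (helper; no stub is closed; nothing here proves `BlochSpreadEightFour`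
unconditionally, nor rung H2, HC_AV or HC): `BlochSpreadEightFour` BY NAME from the named fact
`Bloch1972_semiregularSubschemeLifts` (stub `stub_blochLifts`) and the hypothesis `(SC)` of
`…SupportedClass.lean` — a global class on the total space of the flat family SUPPORTED on it, with
non-zero restriction to the central fibre (Fulton 1998 §19.1 eq. (1) with Prop. 10.1 (a) and Lemma 19.1.1)
— via `relativeClassNear_of_supportedClass` ((F3)+(F4)+(F4′), proved) and
`BlochSpreadEightFour_of_blochLifts_of_relativeClassNear` (the line's glue). This records the smallest
Fulton-side input the line needs after this session: `(SC)` = gap items (F1)+(F5b).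

This file imports a route-dependent Theorems module (`…OfRelativeClassNear`, which imports the route file
for its by-name composition); it is the top of that cone and contains nothing reusable.

References: [Bloch1972Semiregularity] Thm. (7.1), (7.4), Remark (7.5); [Fulton1998] §10.1 Prop. 10.1 (a),
§19.1 eq. (1), Lemma 19.1.1, §19.2 Cor. 19.2 (b).
-/

-- every declaration of this problem lives in `Summit.HodgeConjecture.HodgeConjecture.…` (summit = sub-problem)
set_option linter.dupNamespace false

noncomputable section

open CategoryTheory CategoryTheory.Limits AlgebraicGeometry
open Literature.AlgebraicGeometry.Motives Literature.AlgebraicGeometry.HodgeTheory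

namespace Summit.HodgeConjecture.HodgeConjecture.Theorems

/-- **`BlochSpreadEightFour` from Bloch's lifting fact and `(SC)`.** Conditional on the two displayed
hypotheses; the crux item is NOT closed by this theorem.
[cite: Bloch1972Semiregularity, Thm. (7.4) and Remark (7.5)] [cite: Fulton1998, §19.1 eq. (1) and Lemma 19.1.1] -/
theorem BlochSpreadEightFour_of_blochLifts_of_supportedClass (hB : Bloch1972_semiregularSubschemeLifts)
    (hS : ∀ ⦃n p : ℕ⦄ ⦃𝒳 V : SchemeOver ℂ⦄ (g : 𝒳 ⟶ V), 0 < p → IsSmoothProjectiveFamily g n →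
      AlgebraicGeometry.Smooth V.hom →
      ∀ (𝒲 : Scheme) (ι : 𝒲 ⟶ 𝒳.left), IsClosedImmersion ι → Flat (ι ≫ g.left) →
      ∀ (v₀ : ComplexPoints V) (W₀ : Set (fiberOver g v₀).left), IsClosed W₀ → IsIrreducible W₀ →
      Set.range (pullback.snd ι (fiberι g v₀).left).base = W₀ →
      (∀ z ∈ W₀, (p : ℕ∞) ≤ Order.coheight z) → (∃ z ∈ W₀, Order.coheight z = p) →
      ∃ Γ : complexBetti 𝒳 (2 * p),
        Γ ∈ classesSupportedOn 𝒳 (Set.range ι.base) (2 * p) ∧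
        complexBetti.map (fiberι g v₀) (2 * p) Γ ≠ 0) :
    Summit.HodgeConjecture.HodgeConjecture.Theses.EightfoldTwistedSheafSeeds.BlochSpreadEightFour :=
  BlochSpreadEightFour_of_blochLifts_of_relativeClassNear hB (relativeClassNear_of_supportedClass hS)

end Summit.HodgeConjecture.HodgeConjecture.Theorems

end
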